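import Summits.Parity.GeneralizedHardyLittlewood.Theorems.LiouvilleShiftedTablesTypeI2DilatedMainTerms2
import Literature.NumberTheory.Sieve.LiouvilleClassSumCharacters

/-!
# Main terms of the line `peel-to-drappeau` (crux `TypeI2Dilated`, stmt-Parity-14272) — III: range (iii)

Range (iii) of the reduced block (`Theorems/LiouvilleShiftedTablesTypeI2DilatedMainTerms2.lean`): Möbius
divisor `d ≤ D₀` and conductor `f > F₀` of the twisting primitive character `ψ*`.  For one pair `(p, d)`,
`p = (f, ψ*)`, the class sum `G = ‖∑_{t ≤ N/d, dt ≡ e (L)} λ(t)ψ*(t)‖` is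

* `g`-extracted and expanded in characters mod `L' = L/g`, `g = (e, L)`
  (`Literature/NumberTheory/Sieve/LiouvilleClassSumCharacters.lean`): `classCharNorm_le_sum_Lsup`,
  `G ≤ φ(L')⁻¹ ∑_{(L'',ξ*) ∈ S(L')} Λ*_{L'}(H; ψ* ⊗ ξ*)` for any `H ≥ N/(dg)`;
* summed over `F₀ < f ≤ K` against the weights `ω(f, d) ≤ W/φ(f)` (supported on `(f, q r̃) = 1`) with the
  hybrid mean value theorem for `λ` (`LiouvilleMV.sum_lmvTerm_le`, via
  `Drappeau2017.sum_Ioc_inv_totient_mul_sum_Lsup_crtProd_le`): `range_iii_weighted_le`,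
  `∑_{p : f > F₀} ω(f,d) G ≤ (W/φ(L')) · σ₀(L')² · (330000/F₀) · 𝔅(H, K L')`, where
  `𝔅(H, k) = (H + (H^{5/6} k + H^{1/2} k²)(1 + log H)) log⁴(H k)` is the bracket of the mean value theorem.

Only the term `H/F₀` of `𝔅` is critical (it is summed with `H = 2 + N/(dg)` and `g φ(L') ≥ φ(L)`); the others
carry power savings.  [this line: Lines/peel-to-drappeau.md]
-/

noncomputable section

namespace Summit.Parity.GeneralizedHardyLittlewood.Cruxes.TypeI2Dilated.PeelToDrappeau

open Finset Real Complex
open scoped ArithmeticFunction.sigma Classical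
open Literature.NumberTheory.Sieve Literature.NumberTheory.Sieve.Drappeau2017 LiouvilleMV
open Literature.NumberTheory.LFunctions (crtProd)
open ArithmeticFunction (liouville)

/-! ### Step A: one class sum against the hybrid family -/

/-- **`g`-extraction and character expansion of one class sum.**  For `L ≥ 1`, `(d, L) = 1`, `p = (f, ψ*)` with
`f ≥ 1`, `g = (e, L)`, `L' = L/g` and any `H ≥ N/d/g`:
`G(e; p, d) ≤ φ(L')⁻¹ ∑_{(L'', ξ*) ∈ S(L')} Λ*_{L'}(H; ψ* ⊗ ξ*)`. [this line] -/
theorem classCharNorm_le_sum_Lsup {L : ℕ} (hL : 0 < L) (e : ZMod L) {d : ℕ} (hd : d.Coprime L)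
    (p : Σ f : ℕ, DirichletCharacter ℂ f) (hf : 0 < p.1) (N : ℕ) {H : ℝ}
    (hH : ((N / d / Nat.gcd e.val L : ℕ) : ℝ) ≤ H) :
    classCharNorm L e p d N ≤
      ((Nat.totient (L / Nat.gcd e.val L) : ℝ))⁻¹ *
        ∑ p' ∈ primIndex (L / Nat.gcd e.val L), Lsup (L / Nat.gcd e.val L) (crtProd p.2 p'.2) H := by
  haveI : NeZero L := ⟨hL.ne'⟩
  have hg0 : 0 < Nat.gcd e.val L := Nat.gcd_pos_of_pos_right _ hL
  have hL' : 0 < L / Nat.gcd e.val L :=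
    Nat.div_pos (Nat.le_of_dvd hL (Nat.gcd_dvd_right _ _)) hg0
  have he' : (e.val / Nat.gcd e.val L).Coprime (L / Nat.gcd e.val L) := Nat.coprime_div_gcd_div_gcd hg0
  have hd' : d.Coprime (L / Nat.gcd e.val L) :=
    Nat.Coprime.coprime_dvd_right (Nat.div_dvd_of_dvd (Nat.gcd_dvd_right _ _)) hd
  have h1 := norm_classSum_le_gcd_extract hL hd e.val (N / d) p.2
  rw [ZMod.natCast_zmod_val] at h1
  unfold classCharNorm
  refine h1.trans ((norm_classSum_le_sum_primIndex hL' he' hd' hf p.2 (N / d / Nat.gcd e.val L)).trans ?_)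
  refine mul_le_mul_of_nonneg_left (sum_le_sum fun p' _ => ?_) (inv_nonneg.2 (Nat.cast_nonneg _))
  exact norm_liouvilleCharSum_le_Lsup _ _ hH

/-! ### The bracket of the mean value theorem -/

/-- The bracket `𝔅(H, k) = (H + (H^{5/6} k + H^{1/2} k²)(1 + log H)) log⁴(H k)` of `LiouvilleMV.sum_lmvTerm_le`.
[this line] -/
theorem mvBracket_nonneg {H : ℝ} (hH : 1 ≤ H) {k : ℝ} (hk : 1 ≤ k) :
    0 ≤ (H + (H ^ (5 / 6 : ℝ) * k + H ^ (1 / 2 : ℝ) * k ^ 2) * (1 + Real.log H)) * Real.log (H * k) ^ 4 := by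
  have hlogH : 0 ≤ Real.log H := Real.log_nonneg hH
  have hlog : 0 ≤ Real.log (H * k) := Real.log_nonneg (one_le_mul_of_one_le_of_one_le hH hk)
  positivity

/-- Monotonicity of the bracket in `k` (for `H, k ≥ 1`). [this line] -/
theorem mvBracket_mono {H : ℝ} (hH : 1 ≤ H) {k k' : ℝ} (hk : 1 ≤ k) (hkk' : k ≤ k') :
    (H + (H ^ (5 / 6 : ℝ) * k + H ^ (1 / 2 : ℝ) * k ^ 2) * (1 + Real.log H)) * Real.log (H * k) ^ 4 ≤
      (H + (H ^ (5 / 6 : ℝ) * k' + H ^ (1 / 2 : ℝ) * k' ^ 2) * (1 + Real.log H)) * Real.log (H * k') ^ 4 := by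
  have hH0 : 0 < H := by linarith
  have hk0 : 0 < k := by linarith
  have hlogH : 0 ≤ Real.log H := Real.log_nonneg hH
  have hlog : 0 ≤ Real.log (H * k) := Real.log_nonneg (one_le_mul_of_one_le_of_one_le hH hk)
  have hlogle : Real.log (H * k) ≤ Real.log (H * k') :=
    Real.log_le_log (mul_pos hH0 hk0) (mul_le_mul_of_nonneg_left hkk' hH0.le)
  have hk'0 : 0 < k' := by linarith
  have h1 : 0 ≤ 1 + Real.log H := by linarith
  have hb0 : 0 ≤ H + (H ^ (5 / 6 : ℝ) * k' + H ^ (1 / 2 : ℝ) * k' ^ 2) * (1 + Real.log H) :=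
    add_nonneg hH0.le (mul_nonneg (by positivity) h1)
  gcongr

/-! ### Step B: summing the conductors `f > F₀` against the weights -/

/-- Sums over `primIndexLe K` restricted in the conductor are iterated sums. [folklore] -/
theorem sum_primIndexLe_filter_eq {K : ℕ} (P : ℕ → Prop) [DecidablePred P]
    (F : (Σ f : ℕ, DirichletCharacter ℂ f) → ℝ) :
    ∑ p ∈ (primIndexLe K).filter (fun p => P p.1), F p =
      ∑ f ∈ (Icc 1 K).filter P,
        ∑ ψ ∈ (univ : Finset (DirichletCharacter ℂ f)).filter DirichletCharacter.IsPrimitive, F ⟨f, ψ⟩ := by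
  rw [← sum_sigma]
  refine sum_congr ?_ fun _ _ => rfl
  ext p
  simp only [primIndexLe, mem_filter, mem_sigma]
  tauto

/-- Sums over `primIndex L'` are iterated sums over the divisors `L''` of `L'`. [folklore] -/
theorem sum_primIndex_eq (L' : ℕ) (F : (Σ f : ℕ, DirichletCharacter ℂ f) → ℝ) :
    ∑ p' ∈ primIndex L', F p' =
      ∑ L'' ∈ L'.divisors,
        ∑ ξ ∈ (univ : Finset (DirichletCharacter ℂ L'')).filter DirichletCharacter.IsPrimitive, F ⟨L'', ξ⟩ := by
  rw [primIndex, sum_sigma]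

/-- `∑_{L'' ∣ L'} φ(L'')/L'' ≤ τ(L')` (each term is `≤ 1`). [folklore] -/
theorem sum_divisors_totient_div_le (L' : ℕ) :
    ∑ L'' ∈ L'.divisors, (Nat.totient L'' : ℝ) / L'' ≤ (σ 0 L' : ℝ) := by
  rw [ArithmeticFunction.sigma_zero_apply]
  have h : ∀ L'' ∈ L'.divisors, (Nat.totient L'' : ℝ) / L'' ≤ 1 := by
    intro L'' hL''
    have h0 : 0 < L'' := Nat.pos_of_mem_divisors hL''
    rw [div_le_one (by exact_mod_cast h0)]
    exact_mod_cast Nat.totient_le L''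
  refine (sum_le_sum h).trans ?_
  rw [sum_const, nsmul_eq_mul, mul_one]

/-- **Range (iii), one Möbius divisor `d`, abstract weights.**  Let `L' ≥ 1`, `F₀ ≥ 1`, `K ≥ 1`, `H ≥ 2`, and
weights `w(f) ≤ W/φ(f)` vanishing unless `(f, L') = 1`.  Then
`∑_{(f,ψ*) : F₀ < f ≤ K} w(f) · φ(L')⁻¹ ∑_{(L'',ξ*) ∈ S(L')} Λ*_{L'}(H; ψ* ⊗ ξ*) ≤ (W/φ(L')) σ₀(L')² (330000/F₀) 𝔅(H, K L')`.
[this line] -/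
theorem range_iii_abstract_le {L' : ℕ} (hL' : 0 < L') {F₀ K : ℕ} (hF₀ : 0 < F₀) (hK : 1 ≤ K) {H : ℝ}
    (hH : 2 ≤ H) {W : ℝ} (hW : 0 ≤ W) (w : ℕ → ℝ)
    (hwle : ∀ f, 0 < f → w f ≤ W / Nat.totient f) (hwsupp : ∀ f, ¬ f.Coprime L' → w f = 0) :
    ∑ p ∈ (primIndexLe K).filter (fun p => F₀ < p.1),
        w p.1 * (((Nat.totient L' : ℝ))⁻¹ * ∑ p' ∈ primIndex L', Lsup L' (crtProd p.2 p'.2) H) ≤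
      W / Nat.totient L' * (σ 0 L' : ℝ) ^ 2 * (330000 / F₀) *
        ((H + (H ^ (5 / 6 : ℝ) * (K * L' : ℕ) + H ^ (1 / 2 : ℝ) * ((K * L' : ℕ) : ℝ) ^ 2) *
          (1 + Real.log H)) * Real.log (H * (K * L' : ℕ)) ^ 4) := by
  -- notation
  set B : ℕ → ℝ := fun k => (H + (H ^ (5 / 6 : ℝ) * k + H ^ (1 / 2 : ℝ) * (k : ℝ) ^ 2) *
    (1 + Real.log H)) * Real.log (H * k) ^ 4 with hB
  have hH1 : 1 ≤ H := by linarith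
  have hφL' : (0 : ℝ) < Nat.totient L' := by exact_mod_cast Nat.totient_pos.2 hL'
  have hF₀0 : (0 : ℝ) < F₀ := by exact_mod_cast hF₀
  have hKL' : 1 ≤ K * L' := Nat.mul_pos hK hL'
  have hBmono : ∀ k : ℕ, 1 ≤ k → k ≤ K * L' → B k ≤ B (K * L') := by
    intro k hk hkK
    simp only [hB]
    exact mvBracket_mono hH1 (by exact_mod_cast hk) (by exact_mod_cast hkK)
  have hBnn : 0 ≤ B (K * L') := by
    simp only [hB]; exact mvBracket_nonneg hH1 (by exact_mod_cast hKL')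
  have hLsup_nn : ∀ (f : ℕ) (ψ : DirichletCharacter ℂ f), 0 ≤ ∑ p' ∈ primIndex L', Lsup L' (crtProd ψ p'.2) H :=
    fun f ψ => sum_nonneg fun p' _ => Lsup_nonneg _ _ _
  -- Step 1: replace the weights by `W/φ(f)` on `(f, L') = 1` and drop the other conductors
  have hstep1 : ∑ p ∈ (primIndexLe K).filter (fun p => F₀ < p.1),
      w p.1 * (((Nat.totient L' : ℝ))⁻¹ * ∑ p' ∈ primIndex L', Lsup L' (crtProd p.2 p'.2) H) ≤
      ∑ p ∈ (primIndexLe K).filter (fun p => F₀ < p.1 ∧ p.1.Coprime L'),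
        W / Nat.totient p.1 * (((Nat.totient L' : ℝ))⁻¹ * ∑ p' ∈ primIndex L', Lsup L' (crtProd p.2 p'.2) H) := by
    rw [← filter_filter, sum_filter (fun p : Σ f : ℕ, DirichletCharacter ℂ f => p.1.Coprime L')]
    refine sum_le_sum fun p hp => ?_
    have hf0 : 0 < p.1 := (mem_primIndexLe.1 (mem_filter.1 hp).1).1
    have hX : 0 ≤ ((Nat.totient L' : ℝ))⁻¹ * ∑ p' ∈ primIndex L', Lsup L' (crtProd p.2 p'.2) H :=
      mul_nonneg (inv_nonneg.2 hφL'.le) (hLsup_nn _ _)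
    split_ifs with hcop
    · exact mul_le_mul_of_nonneg_right (hwle p.1 hf0) hX
    · rw [hwsupp p.1 hcop, zero_mul]
  refine hstep1.trans ?_
  -- Step 2: iterate the sums: over `f`, `ψ*`, `L'' ∣ L'`, `ξ*`
  rw [sum_primIndexLe_filter_eq (fun f => F₀ < f ∧ f.Coprime L')]
  have hstep2 : ∀ f ∈ (Icc 1 K).filter (fun f => F₀ < f ∧ f.Coprime L'),
      ∑ ψ ∈ (univ : Finset (DirichletCharacter ℂ f)).filter DirichletCharacter.IsPrimitive,
        W / Nat.totient f * (((Nat.totient L' : ℝ))⁻¹ *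
          ∑ p' ∈ primIndex L', Lsup L' (crtProd (⟨f, ψ⟩ : Σ f : ℕ, DirichletCharacter ℂ f).2 p'.2) H) =
      W / Nat.totient L' * ∑ L'' ∈ L'.divisors, (((Nat.totient f : ℝ))⁻¹ *
        ∑ ψ ∈ (univ : Finset (DirichletCharacter ℂ f)).filter DirichletCharacter.IsPrimitive,
          ∑ ξ ∈ (univ : Finset (DirichletCharacter ℂ L'')).filter DirichletCharacter.IsPrimitive,
            Lsup L' (crtProd ψ ξ) H) := by
    intro f _
    simp_rw [sum_primIndex_eq L']
    rw [mul_sum]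
    simp_rw [mul_sum]
    rw [sum_comm]
    refine sum_congr rfl fun ψ _ => sum_congr rfl fun L'' _ => sum_congr rfl fun ξ _ => ?_
    rw [div_eq_mul_inv, div_eq_mul_inv]
    ring
  rw [sum_congr rfl hstep2, ← mul_sum, sum_comm]
  -- Step 3: for each `L'' ∣ L'`, the range lemma and the mean value theorem
  have hstep3 : ∀ L'' ∈ L'.divisors,
      ∑ f ∈ (Icc 1 K).filter (fun f => F₀ < f ∧ f.Coprime L'), ((Nat.totient f : ℝ))⁻¹ *
        ∑ ψ ∈ (univ : Finset (DirichletCharacter ℂ f)).filter DirichletCharacter.IsPrimitive,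
          ∑ ξ ∈ (univ : Finset (DirichletCharacter ℂ L'')).filter DirichletCharacter.IsPrimitive,
            Lsup L' (crtProd ψ ξ) H ≤
      (Nat.totient L'' : ℝ) / L'' * ((330000 / F₀) * (σ 0 L' : ℝ) * B (K * L')) := by
    intro L'' hL''
    have hL''0 : 0 < L'' := Nat.pos_of_mem_divisors hL''
    have hL''le : L'' ≤ L' := Nat.divisor_le hL''
    have hφL'' : (0 : ℝ) ≤ Nat.totient L'' := Nat.cast_nonneg _
    -- enlarge the `f`-range to `(F₀, K]` with `(f, L'') = 1`
    have hsub : (Icc 1 K).filter (fun f => F₀ < f ∧ f.Coprime L') ⊆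
        (Ioc F₀ K).filter (fun f => f.Coprime L'') := by
      intro f hf
      rw [mem_filter, mem_Icc] at hf
      rw [mem_filter, mem_Ioc]
      exact ⟨⟨hf.2.1, hf.1.2⟩, Nat.Coprime.coprime_dvd_right (Nat.dvd_of_mem_divisors hL'') hf.2.2⟩
    refine (sum_le_sum_of_subset_of_nonneg hsub fun f _ _ => ?_).trans ?_
    · exact mul_nonneg (inv_nonneg.2 (Nat.cast_nonneg _))
        (sum_nonneg fun ψ _ => sum_nonneg fun ξ _ => Lsup_nonneg _ _ _)
    refine (sum_Ioc_inv_totient_mul_sum_Lsup_crtProd_le L' hL''0 hF₀ K H).trans ?_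
    have hk1 : 1 ≤ K * L'' := Nat.mul_pos hK hL''0
    have hmv := sum_lmvTerm_le (r := L') hL'.ne' hk1 hH
    have hkle : K * L'' ≤ K * L' := Nat.mul_le_mul_left K hL''le
    calc (Nat.totient L'' : ℝ) / (F₀ * L'') * ∑ k ∈ Icc 1 (K * L''), lmvTerm L' H k
        ≤ (Nat.totient L'' : ℝ) / (F₀ * L'') * (330000 * (σ 0 L' : ℝ) * B (K * L'')) := by
          refine mul_le_mul_of_nonneg_left ?_ (by positivity)
          simpa only [hB, mul_assoc] using hmv
      _ ≤ (Nat.totient L'' : ℝ) / (F₀ * L'') * (330000 * (σ 0 L' : ℝ) * B (K * L')) := by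
          refine mul_le_mul_of_nonneg_left ?_ (by positivity)
          exact mul_le_mul_of_nonneg_left (hBmono _ hk1 hkle) (by positivity)
      _ = (Nat.totient L'' : ℝ) / L'' * ((330000 / F₀) * (σ 0 L' : ℝ) * B (K * L')) := by
          field_simp
  refine (mul_le_mul_of_nonneg_left (sum_le_sum hstep3) (div_nonneg hW hφL'.le)).trans ?_
  rw [← sum_mul]
  have hdiv := sum_divisors_totient_div_le L'
  have hσ : (0 : ℝ) ≤ σ 0 L' := Nat.cast_nonneg _
  calc W / Nat.totient L' * ((∑ L'' ∈ L'.divisors, (Nat.totient L'' : ℝ) / L'') *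
        ((330000 / F₀) * (σ 0 L' : ℝ) * B (K * L')))
      ≤ W / Nat.totient L' * ((σ 0 L' : ℝ) * ((330000 / F₀) * (σ 0 L' : ℝ) * B (K * L'))) := by
        refine mul_le_mul_of_nonneg_left ?_ (div_nonneg hW hφL'.le)
        exact mul_le_mul_of_nonneg_right hdiv (by positivity)
    _ = _ := by simp only [hB]; ring

/-- **Range (iii), one Möbius divisor `d`, for the block weights.**  With `L ∣ q r̃` (in the application
`L = lcm(q, r̃)`), `(d, q r̃) = 1`, `g = (e, L)`, `L' = L/g`, `F₀, K ≥ 1` and any `H ≥ max(2, N/d/g)`: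
`∑_{(f,ψ*) : F₀ < f ≤ K} ω(f, d) G(e; (f,ψ*), d) ≤ (W(S)/φ(L')) σ₀(L')² (330000/F₀) 𝔅(H, K L')`. [this line] -/
theorem range_iii_d_le (c : ℤ) {q r L : ℕ} (hL : 0 < L) (hLqr : L ∣ q * r) (Slo S : ℝ) (e : ZMod L)
    {d : ℕ} (hd : d.Coprime (q * r)) {F₀ K : ℕ} (hF₀ : 0 < F₀) (hK : 1 ≤ K) (N : ℕ) {H : ℝ} (hH : 2 ≤ H)
    (hHN : ((N / d / Nat.gcd e.val L : ℕ) : ℝ) ≤ H) :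
    ∑ p ∈ (primIndexLe K).filter (fun p => F₀ < p.1),
        omegaW c q r Slo S p.1 d * classCharNorm L e p d N ≤
      weightW S / Nat.totient (L / Nat.gcd e.val L) * (σ 0 (L / Nat.gcd e.val L) : ℝ) ^ 2 * (330000 / F₀) *
        ((H + (H ^ (5 / 6 : ℝ) * (K * (L / Nat.gcd e.val L) : ℕ) +
            H ^ (1 / 2 : ℝ) * ((K * (L / Nat.gcd e.val L) : ℕ) : ℝ) ^ 2) *
          (1 + Real.log H)) * Real.log (H * (K * (L / Nat.gcd e.val L) : ℕ)) ^ 4) := by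
  have hg0 : 0 < Nat.gcd e.val L := Nat.gcd_pos_of_pos_right _ hL
  have hL' : 0 < L / Nat.gcd e.val L := Nat.div_pos (Nat.le_of_dvd hL (Nat.gcd_dvd_right _ _)) hg0
  have hdL : d.Coprime L := Nat.Coprime.coprime_dvd_right hLqr hd
  -- pointwise: `ω G ≤ ω · φ(L')⁻¹ Σ Λ*`
  have hpt : ∀ p ∈ (primIndexLe K).filter (fun p => F₀ < p.1),
      omegaW c q r Slo S p.1 d * classCharNorm L e p d N ≤
        omegaW c q r Slo S p.1 d * (((Nat.totient (L / Nat.gcd e.val L) : ℝ))⁻¹ *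
          ∑ p' ∈ primIndex (L / Nat.gcd e.val L), Lsup (L / Nat.gcd e.val L) (crtProd p.2 p'.2) H) := by
    intro p hp
    have hf0 : 0 < p.1 := (mem_primIndexLe.1 (mem_filter.1 hp).1).1
    exact mul_le_mul_of_nonneg_left (classCharNorm_le_sum_Lsup hL e hdL p hf0 N hHN)
      (omegaW_nonneg _ _ _ _ _ _ _)
  refine (sum_le_sum hpt).trans ?_
  refine range_iii_abstract_le hL' hF₀ hK hH (weightW_nonneg' S) (fun f => omegaW c q r Slo S f d)
    (fun f hf => omegaW_le_div_totient_left c q r Slo S hf d) ?_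
  intro f hf
  refine omegaW_eq_zero_of_not_coprime_left c Slo S d fun hfqr => hf ?_
  exact Nat.Coprime.coprime_dvd_right ((Nat.div_dvd_of_dvd (Nat.gcd_dvd_right _ _)).trans hLqr) hfqr

/-- Landing anchor of the main-terms chain, file 3 (range (iii)); registered stub `mainTermsChain5_anchor`.
-/
theorem mainTermsChain5_anchor : True := trivial

end Summit.Parity.GeneralizedHardyLittlewood.Cruxes.TypeI2Dilated.PeelToDrappeau

end
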